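import Summits.Parity.GeneralizedHardyLittlewood.Theorems.GreenTaoLevelTwoMNTwoDualTrilinear

/-!
# Route `GreenTaoLevelTwo`, crux `MNTwo` (stmt-Parity-21276), line `birth`, stub `stub_mnVertical`:
# the averaging step of GT 2008b Prop. 15 in `ℤ/pℤ` (approximate `U²`-duality ⇒ orthogonality)

Brick for block V2 of the `stub_mnVertical` census (B. Green, T. Tao, *Quadratic uniformity of the
Möbius function*, Ann. Inst. Fourier 58 (2008) = arXiv:math/0606087, §6, proof of Prop. 15: "Hence we
conclude that `f(x) = f(x+h₁+h₂) F(h₁) F(h₂) e(−2φ(n_s)) + O(ε + κ)` … we may sum over `X_s` and deduce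
that `𝔼_x μ̃(x)1_{X_s}(x) f(x) = 𝔼_{h₁,h₂} 𝔼_x μ̃(x) f(x+h₁+h₂)F(h₁)F(h₂)e(2φ(n_s)) + O(…)` … it is enough to
prove that `𝔼_{h₁,h₂,x} μ̃(x) f(x+h₁+h₂) F(h₁) F(h₂) ≪_A log^{−A} N`").  Abstract `ℤ/pℤ` form, def-free:
if `a f(x)` is, for all shifts `h₁, h₂ ∈ A`, within `w(x)` of `c · a(x) f(x+h₁+h₂)F(h₁)F(h₂)` then
`‖Σ_x a(x) f(x)‖ ≤ Σ_x w(x) + ‖c‖ √(N/#A) · sup_ξ ‖â(ξ)‖` (the last factor from `…MNTwoDualTrilinear`).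

* `norm_sum_le_of_approx_dual` — the statement above.

References: [GreenTao2008QuadraticMobius] arXiv:math/0606087 §6, proof of Proposition 15.
-/

noncomputable section

namespace Summit.Parity.GeneralizedHardyLittlewood.GreenTaoLevelTwoMNTwoDualApproximation

open Finset ZMod
open Literature.NumberTheory.Sieve
open Summit.Parity.GeneralizedHardyLittlewood.GreenTaoLevelTwoMNTwoDualTrilinear (norm_sum_sum_sum_shift_le)

variable {N : ℕ} [NeZero N]

/-- **Averaging step of GT 2008b Prop. 15 (abstract `ℤ/Nℤ` form).**  Let `A ≠ ∅`, `‖f‖ ≤ 1`,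
`‖F‖ ≤ 1` on `A`, all Fourier coefficients of `a` at most `D`, and suppose that for every `x` and all
`h₁, h₂ ∈ A`, `‖a(x) f(x) − c · a(x) F(h₁) F(h₂) f(x+h₁+h₂)‖ ≤ w(x)`.  Then
`‖Σ_x a(x) f(x)‖ ≤ Σ_x w(x) + ‖c‖ · √(N/#A) · D`.
[cite: GreenTao2008QuadraticMobius, proof of Proposition 15] -/
theorem norm_sum_le_of_approx_dual (A : Finset (ZMod N)) (hA : A.Nonempty) (a f F : ZMod N → ℂ)
    (c : ℂ) (w : ZMod N → ℝ) (hf : ∀ y, ‖f y‖ ≤ 1) (hF : ∀ h ∈ A, ‖F h‖ ≤ 1) {D : ℝ} (hD0 : 0 ≤ D)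
    (hD : ∀ ξ : ZMod N, ‖∑ x : ZMod N, a x * stdAddChar (x * ξ)‖ ≤ D)
    (happrox : ∀ x, ∀ h₁ ∈ A, ∀ h₂ ∈ A,
      ‖a x * f x - c * (a x * F h₁ * F h₂ * f (x + h₁ + h₂))‖ ≤ w x) :
    ‖∑ x : ZMod N, a x * f x‖ ≤ ∑ x : ZMod N, w x + ‖c‖ * Real.sqrt (N / #A) * D := by
  classical
  have hNpos : (0 : ℝ) < N := by exact_mod_cast Nat.pos_of_ne_zero (NeZero.ne N)
  have hApos : (0 : ℝ) < #A := by exact_mod_cast hA.card_pos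
  -- average the hypothesis over `(h₁, h₂) ∈ A × A`
  set T : ℂ := ∑ h₂ ∈ A, ∑ h₁ ∈ A, ∑ x : ZMod N, a x * F h₁ * F h₂ * f (x + h₁ + h₂) with hT
  have hkey : ‖((#A : ℂ) * #A) * ∑ x : ZMod N, a x * f x - c * T‖ ≤ (#A : ℝ) * #A * ∑ x : ZMod N, w x := by
    have e1 : ∑ h₂ ∈ A, ∑ h₁ ∈ A, ∑ x : ZMod N,
        (a x * f x - c * (a x * F h₁ * F h₂ * f (x + h₁ + h₂))) =
        ∑ h₂ ∈ A, ∑ h₁ ∈ A, (∑ x : ZMod N, a x * f x) -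
          ∑ h₂ ∈ A, ∑ h₁ ∈ A, ∑ x : ZMod N, c * (a x * F h₁ * F h₂ * f (x + h₁ + h₂)) := by
      rw [← Finset.sum_sub_distrib]
      refine Finset.sum_congr rfl fun h₂ _ => ?_
      rw [← Finset.sum_sub_distrib]
      refine Finset.sum_congr rfl fun h₁ _ => ?_
      rw [← Finset.sum_sub_distrib]
    have e2 : ∑ h₂ ∈ A, ∑ h₁ ∈ A, (∑ x : ZMod N, a x * f x) =
        ((#A : ℂ) * #A) * ∑ x : ZMod N, a x * f x := by
      rw [Finset.sum_const, Finset.sum_const, smul_smul, nsmul_eq_mul]; push_cast; ring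
    have e3 : ∑ h₂ ∈ A, ∑ h₁ ∈ A, ∑ x : ZMod N, c * (a x * F h₁ * F h₂ * f (x + h₁ + h₂)) = c * T := by
      rw [hT, Finset.mul_sum]
      refine Finset.sum_congr rfl fun h₂ _ => ?_
      rw [Finset.mul_sum]
      refine Finset.sum_congr rfl fun h₁ _ => ?_
      rw [Finset.mul_sum]
    have e : ((#A : ℂ) * #A) * ∑ x : ZMod N, a x * f x - c * T =
        ∑ h₂ ∈ A, ∑ h₁ ∈ A, ∑ x : ZMod N,
          (a x * f x - c * (a x * F h₁ * F h₂ * f (x + h₁ + h₂))) := by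
      rw [e1, e2, e3]
    rw [e]
    calc ‖∑ h₂ ∈ A, ∑ h₁ ∈ A, ∑ x : ZMod N, (a x * f x - c * (a x * F h₁ * F h₂ * f (x + h₁ + h₂)))‖
        ≤ ∑ h₂ ∈ A, ‖∑ h₁ ∈ A, ∑ x : ZMod N, (a x * f x - c * (a x * F h₁ * F h₂ * f (x + h₁ + h₂)))‖ :=
          norm_sum_le _ _
      _ ≤ ∑ h₂ ∈ A, ∑ h₁ ∈ A, ‖∑ x : ZMod N, (a x * f x - c * (a x * F h₁ * F h₂ * f (x + h₁ + h₂)))‖ :=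
          Finset.sum_le_sum fun h₂ _ => norm_sum_le _ _
      _ ≤ ∑ h₂ ∈ A, ∑ h₁ ∈ A, ∑ x : ZMod N, w x :=
          Finset.sum_le_sum fun h₂ hh₂ => Finset.sum_le_sum fun h₁ hh₁ =>
            (norm_sum_le _ _).trans (Finset.sum_le_sum fun x _ => happrox x h₁ hh₁ h₂ hh₂)
      _ = (#A : ℝ) * #A * ∑ x : ZMod N, w x := by
          rw [Finset.sum_const, Finset.sum_const, nsmul_eq_mul, nsmul_eq_mul]; ring
  -- the dual estimate for `T`
  have hTle : ‖T‖ ≤ #A * Real.sqrt (#A * N) * D := norm_sum_sum_sum_shift_le A a f F hf hF hD0 hD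
  -- combine: `‖S‖ ≤ (‖#A² S − cT‖ + ‖c‖‖T‖)/#A²`
  have hA2 : (0 : ℝ) < (#A : ℝ) * #A := mul_pos hApos hApos
  have hnormA : ‖((#A : ℂ) * #A)‖ = (#A : ℝ) * #A := by
    rw [norm_mul, Complex.norm_natCast]
  have h1 : (#A : ℝ) * #A * ‖∑ x : ZMod N, a x * f x‖ ≤
      (#A : ℝ) * #A * ∑ x : ZMod N, w x + ‖c‖ * (#A * Real.sqrt (#A * N) * D) := by
    have h2 : ‖((#A : ℂ) * #A) * ∑ x : ZMod N, a x * f x‖ ≤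
        ‖((#A : ℂ) * #A) * ∑ x : ZMod N, a x * f x - c * T‖ + ‖c * T‖ := by
      have := norm_add_le (((#A : ℂ) * #A) * ∑ x : ZMod N, a x * f x - c * T) (c * T)
      rwa [sub_add_cancel] at this
    rw [norm_mul, hnormA] at h2
    have h3 : ‖c * T‖ ≤ ‖c‖ * (#A * Real.sqrt (#A * N) * D) := by
      rw [norm_mul]; exact mul_le_mul_of_nonneg_left hTle (norm_nonneg _)
    linarith
  have hsqrt : #A * Real.sqrt (#A * N) = (#A : ℝ) * #A * Real.sqrt (N / #A) := by
    have e : (#A : ℝ) * N = (#A * #A) * (N / #A) := by field_simp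
    rw [e, Real.sqrt_mul (by positivity), Real.sqrt_mul_self hApos.le]
    ring
  rw [hsqrt] at h1
  have h4 : (#A : ℝ) * #A * ‖∑ x : ZMod N, a x * f x‖ ≤
      (#A : ℝ) * #A * (∑ x : ZMod N, w x + ‖c‖ * Real.sqrt (N / #A) * D) := by
    calc _ ≤ _ := h1
      _ = _ := by ring
  exact le_of_mul_le_mul_left h4 hA2

end Summit.Parity.GeneralizedHardyLittlewood.GreenTaoLevelTwoMNTwoDualApproximation
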